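/-
Copyright (c) 2026 the pub-hodgecm-mathlib formalisation cell (harness21).  Prover seat hodgecm-mathlib-LH4-p07 (g9), req620 Track A «(D-RAM) FOUR-FRAME» squad
(STAGE-1b, row-(2) lineage; dealer LH4-plan (g13) WORD #58 RULING A ∕ #69 (4) ∕ #75 (1): owner of the two-literal census law of `lev_{a,m}`), 2026-09-04.
-/
import Summits.HodgeConjecture.HodgeConjecture.Theorems.F0P3cDyRamLevelsSocketPrelude   -- ★ p860127 (this seat): eigenvalue token letters; brings ★ p859341 GUARD LETTER
import HarnessLib

/-!
# Crux `H413`, line LH4 «(D-RAM) FOUR-FRAME» — STAGE-1b, row (2): (SOCKET-lev TOKENS) «THE LEVEL PIECE'S TOKENS NEAR 1, ABSTRACT FRAME»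

Cell `hodgecm-mathlib` (D-0151), FLOOR 0, crux item H413 = `stmt-HodgeConjecture-24833`, route of record `HCCMUnconditional`; squad F0∕P3c∕LH4; lane
`--supports stmt-HodgeConjecture-24833 --as helper` (count-neutral; pays NO tier-0 row).  THEOREMS ONLY (no `def`, no instance, no notation, no `sorry`).
OWNER'S ORGAN №14, shared by the three level sockets (RamK `levelsCensusB` here; U ∕ RamM twins by LH4-p08 (g8)): in the abstract frame `jE : E →+* M` (`ρ` the
involution of `M`, `|jE x| = |x|`, `ρ ∘ jE = jE`), for an eigenvalue `lam` (`ρ lam = jE tr − lam`, `lam² = jE tr·lam − jE det`, conductor token `jλ`, depth token `m` of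
`lam − jE u`) and a piece `(a, b)` with `a ≤ b`, `a ≤ m`, the NEAR-1 LETTERS `|det − 1|, |tr − 2|, |u − 1| ≤ |ϖ|^{2b}` yield the trace-level token `nν ≥ b` of `lam + jE u − 2`
and every token ∕ level hypothesis ★ p860083 (C2-lev-cutoff-CM) asks for: `|μ₁| = exp(−(m − a))` for `μ₁ = (jEϖ^a)⁻¹(lam − jE u)`, `|μ₂| = exp(−(m + nν − b))` for the square
multiplier, `|lam − ρlam| = |jEϖ|^{jλ}|α − ρα|`, `|lam − 1| ≤ |jEϖ^a|`, `|(lam − 1)²| ≤ |jEϖ^b|`, the deep trace letter `|lam + ρlam − 2| ≤ |jEϖ|^{b−a}`, `|u − 1| ≤ |ϖ|^a`, `|(u − 1)²| ≤ |ϖ|^b`.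
**`levelTokens_near_one`**.  Proof: ★ p860127's letters + ★ p859341 `sub_one_sq_sub_map_sub_one_sq` + uniformiser-power bookkeeping.
HONEST LABEL.  Count-neutral; `HC_CM` is proved only modulo the 7 printed citations (2 remaining named inputs: hLiu418 = `stmt-HodgeConjecture-24832`, h413 =
`stmt-HodgeConjecture-24833`) until rung 0 closes.

## References
* [Rogawski1990] J. D. Rogawski, *Automorphic Representations of Unitary Groups in Three Variables*, Ann. of Math. Stud. 123 (1990): §4.9 Prop. 4.9.1 (b) p. 55, Lemma 4.9.3 p. 56.
* [Serre1979] J.-P. Serre, *Local Fields*, GTM 67 (1979): Ch. II §1.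
-/

set_option autoImplicit false

namespace Summit.HodgeConjecture.HodgeConjecture.Cruxes.H413.F0P3cDyRamLevelsSocketTokens

open WithZero
open scoped Valued
open Summit.HodgeConjecture.HodgeConjecture.Cruxes.H413.F0P3cDyRamLevelsSocketPrelude
open Summit.HodgeConjecture.HodgeConjecture.Cruxes.H413.F0P3cDyRamJointProfileCensusGuardLetter (sub_one_sq_sub_map_sub_one_sq)

-- `M : Type`: ★ p859341 GUARD LETTER (`sub_one_sq_sub_map_sub_one_sq`) is stated in universe 0; the sockets instantiate `M := E′_{w₁}`.
variable {E : Type*} {M : Type} [Field E] [Valued E ℤᵐ⁰] [Field M] [Valued M ℤᵐ⁰] {ρ : M →+* M}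

/-- **(SOCKET-lev TOKENS) THE LEVEL PIECE'S TOKENS NEAR 1.**  See the module docstring: from the near-1 letters `|det − 1|, |tr − 2|, |u − 1| ≤ |ϖ|^{2b}` and the eigenvalue
letters, the trace-level token `nν ≥ b` and the nine token ∕ level facts the CM-place cutoff form consumes.
[cite: Rogawski1990, §4.9 Prop. 4.9.1 (b) p. 55, Lemma 4.9.3 p. 56] [cite: Serre1979, Ch. II §1] -/
theorem levelTokens_near_one (jE : E →+* M) (hvρ : ∀ x, Valued.v (ρ x) = Valued.v x) (hjv : ∀ x, Valued.v (jE x) = Valued.v x)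
    (hρj : ∀ x, ρ (jE x) = jE x) {ϖ : E} (hϖ : Valued.v ϖ = exp (-1 : ℤ))
    {lam : M} {tr det u : E} (hρlam : ρ lam = jE tr - lam) (hlam2 : lam * lam = jE tr * lam - jE det)
    {α : M} (hα : Valued.v (α - ρ α) = 1) {jl m : ℕ} (hjlv : Valued.v (lam - ρ lam) = exp (-(jl : ℤ)))
    (hm : Valued.v (lam - jE u) = exp (-(m : ℤ))) {a b : ℕ} (hab : a ≤ b) (ham : a ≤ m)
    (hdet : Valued.v (det - 1) ≤ Valued.v ϖ ^ (2 * b)) (htr : Valued.v (tr - 2) ≤ Valued.v ϖ ^ (2 * b))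
    (hu1 : Valued.v (u - 1) ≤ Valued.v ϖ ^ (2 * b)) :
    ∃ nν : ℕ, b ≤ nν ∧ Valued.v (lam + jE u - 2) = Valued.v (jE ϖ) ^ nν ∧
      Valued.v ((jE ϖ ^ a)⁻¹ * (lam - jE u)) = exp (-((m - a : ℕ) : ℤ)) ∧
      Valued.v ((jE ϖ ^ b)⁻¹ * ((lam - 1) * (lam - 1) - jE ((u - 1) ^ 2))) = exp (-((m + nν - b : ℕ) : ℤ)) ∧
      Valued.v (lam - ρ lam) = Valued.v (jE ϖ) ^ jl * Valued.v (α - ρ α) ∧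
      Valued.v (lam - 1) ≤ Valued.v (jE ϖ ^ a) ∧ Valued.v ((lam - 1) * (lam - 1)) ≤ Valued.v (jE ϖ ^ b) ∧
      Valued.v (lam + ρ lam - 2) ≤ Valued.v (jE ϖ) ^ (b - a) ∧
      Valued.v (u - 1) ≤ Valued.v ϖ ^ a ∧ Valued.v ((u - 1) ^ 2) ≤ Valued.v ϖ ^ b := by
  have hϖE : Valued.v (jE ϖ) = exp (-1 : ℤ) := by rw [hjv, hϖ]
  have hϖE0 : jE ϖ ≠ 0 := fun h0 => by rw [h0, map_zero] at hϖE; exact zero_ne_coe hϖE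
  have hϖE1 : Valued.v (jE ϖ) < 1 := by rw [hϖE, ← exp_zero, exp_lt_exp]; norm_num
  have hpowE : ∀ k l : ℕ, l ≤ k → Valued.v ϖ ^ k ≤ Valued.v ϖ ^ l := fun k l h => (pow_le_pow_iff_of_uniformiser hϖ k l).2 h
  have hpowM : ∀ k l : ℕ, l ≤ k → Valued.v (jE ϖ) ^ k ≤ Valued.v (jE ϖ) ^ l := fun k l h => (pow_le_pow_iff_of_uniformiser hϖE k l).2 h
  have hϖE' : Valued.v (jE ϖ) = Valued.v ϖ := hjv ϖ
  -- `lam` is moved by `ρ` (its conductor token is finite), hence is neither `jE u` nor `2 − jE u`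
  have hlamne : ρ lam ≠ lam := fun h0 => by
    have h1 := hjlv
    rw [h0, sub_self, map_zero] at h1
    exact zero_ne_coe h1
  obtain ⟨-, hν0⟩ := sub_ne_zero_and_add_sub_two_ne_zero hlamne (hρj u)
  -- `|lam − 1| ≤ |ϖ|^b` and its consequences
  have hlam1 : Valued.v (lam - 1) ≤ Valued.v (jE ϖ) ^ b := by
    rw [hϖE']; exact v_sub_one_le_pow jE hvρ hρlam hlam2 hjv hdet htr
  have hlev : Valued.v (lam - 1) ≤ Valued.v (jE ϖ ^ a) := by rw [map_pow]; exact hlam1.trans (hpowM b a hab)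
  have hlev2 : Valued.v ((lam - 1) * (lam - 1)) ≤ Valued.v (jE ϖ ^ b) := by
    rw [map_mul, map_pow]
    calc Valued.v (lam - 1) * Valued.v (lam - 1) ≤ Valued.v (jE ϖ) ^ b * Valued.v (jE ϖ) ^ b := mul_le_mul' hlam1 hlam1
      _ = Valued.v (jE ϖ) ^ (2 * b) := by rw [← pow_add, two_mul]
      _ ≤ Valued.v (jE ϖ) ^ b := hpowM _ _ (by omega)
  have hdeep : Valued.v (lam + ρ lam - 2) ≤ Valued.v (jE ϖ) ^ (b - a) := by
    rw [hϖE']; exact (v_add_map_sub_two_le jE hρlam hjv htr).trans (hpowE _ _ (by omega))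
  have huc : Valued.v (u - 1) ≤ Valued.v ϖ ^ a := hu1.trans (hpowE _ _ (by omega))
  have huc2 : Valued.v ((u - 1) ^ 2) ≤ Valued.v ϖ ^ b := by
    rw [map_pow, pow_two]
    calc Valued.v (u - 1) * Valued.v (u - 1) ≤ Valued.v ϖ ^ (2 * b) * Valued.v ϖ ^ (2 * b) := mul_le_mul' hu1 hu1
      _ = Valued.v ϖ ^ (4 * b) := by rw [← pow_add]; ring_nf
      _ ≤ Valued.v ϖ ^ b := hpowE _ _ (by omega)
  -- the trace-level token `nν ≥ b` of `lam + jE u − 2 = (lam − 1) + jE (u − 1)`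
  have hνle : Valued.v (lam + jE u - 2) ≤ Valued.v (jE ϖ) ^ b := by
    rw [show lam + jE u - 2 = (lam - 1) + jE (u - 1) by rw [map_sub, map_one]; ring]
    refine (Valuation.map_add _ _ _).trans (max_le hlam1 ?_)
    rw [hjv, hϖE']; exact hu1.trans (hpowE _ _ (by omega))
  obtain ⟨nν, hnν⟩ : ∃ nν : ℕ, Valued.v (lam + jE u - 2) = Valued.v (jE ϖ) ^ nν :=
    exists_eq_pow_of_le_one hϖE hν0 (hνle.trans (pow_le_one₀ zero_le hϖE1.le))
  have hnνb : b ≤ nν := (pow_le_pow_iff_of_uniformiser hϖE nν b).1 (hnν ▸ hνle)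
  -- the two multipliers' depth tokens
  have htea : Valued.v (jE ϖ ^ a) = exp (-(a : ℤ)) := by rw [map_pow, hϖE, ← exp_nsmul, nsmul_eq_mul, mul_neg, mul_one]
  have hm₁ : Valued.v ((jE ϖ ^ a)⁻¹ * (lam - jE u)) = exp (-((m - a : ℕ) : ℤ)) := by
    rw [map_mul, map_inv₀, htea, hm, ← exp_neg, ← exp_add]; congr 1; omega
  have hm₂ : Valued.v ((jE ϖ ^ b)⁻¹ * ((lam - 1) * (lam - 1) - jE ((u - 1) ^ 2))) = exp (-((m + nν - b : ℕ) : ℤ)) := by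
    rw [sub_one_sq_sub_map_sub_one_sq, map_mul, map_inv₀, map_pow, map_mul, hm, hnν, hϖE, ← exp_nsmul, ← exp_nsmul, ← exp_neg, ← exp_add, ← exp_add]
    congr 1; simp only [nsmul_eq_mul]; omega
  have hjl' : Valued.v (lam - ρ lam) = Valued.v (jE ϖ) ^ jl * Valued.v (α - ρ α) := by
    rw [hjlv, hα, mul_one, hϖE, ← exp_nsmul, nsmul_eq_mul, mul_neg, mul_one]
  exact ⟨nν, hnνb, hnν, hm₁, hm₂, hjl', hlev, hlev2, hdeep, huc, huc2⟩

end Summit.HodgeConjecture.HodgeConjecture.Cruxes.H413.F0P3cDyRamLevelsSocketTokens
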